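import Mathlib
import HarnessLib
import Literature.MathematicalPhysics.KineticTheory.HardSphereEuler
import Literature.MathematicalPhysics.KineticTheory.BackwardCluster
import Summits.AtomisticToContinuum.HydrodynamicLimit.Theses.RelayRaceLocality
import Summits.AtomisticToContinuum.HydrodynamicLimit.Theorems.RelayRaceLocalityGibbsLightConeStubReduction

/-!
# Stub `stub_reductionLog` of the line `Sketch` (log-window-tagged-tail) for the crux
`RelayRaceLocality.GibbsLightCone` (stmt-AtomisticToContinuum-12501)

Registered stub of the lead prover's reshaped skeleton (`Cruxes/GibbsLightCone/Lines/Sketch.lean`,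
revision 3): THE LOG-WINDOW REDUCTION. Window composition + cluster shift + invariance of the
homogeneous Gibbs law + null off-good + the LOG-window bookkeeping (`stub_asymptoticsLog`: windows of
`1 ≤ M_N ≤ K log(N+2)` mean free times tiling `(0, t]` exactly) + the tagged LOG-window span tail
(C⁺_log: the one-particle, one-window span tail `≤ C e^{-cM}`, required only for
`1 ≤ M ≤ K log(N+2)`, every `K > 0`) imply the crux with cone speed `c := max λ 1 · √θ`.
Same proof as the strong-form `stub_reduction` (landed, imported for its helpers
`reduction_cover`, `reduction_union_bound`, `reduction_iUnion_le`, `reduction_speed`,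
`reduction_ofReal_bound`), the tail being consumed only at `M = M_N ≤ K log(N+2)` with the `K`
produced by the bookkeeping.

References: Lieb–Robinson (doi:10.1007/bf01645779) for the shape of the bound; APST 2015 §5 and
PS 2021 §1.1 for backward clusters.
-/

namespace Summit.AtomisticToContinuum.HydrodynamicLimit.Theorems.LogWindowTaggedTail

open Literature.MathematicalPhysics.KineticTheory Literature.Analysis.FluidPDE MeasureTheory Filter Set

open scoped ENNReal

/-- THE LOG-WINDOW REDUCTION (registered stub `stub_reductionLog` of the line `Sketch` for the
crux `GibbsLightCone`, stmt-AtomisticToContinuum-12501): window composition + cluster shift + invariance + null off-good +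
log-window bookkeeping + the tagged LOG-window span tail imply the crux, with cone speed
`c := max λ 1 · √θ` (same proof as `stub_reduction`, the tail being consumed only at
`M = M_N ≤ K log(N+2)`). [folklore] -/
theorem stub_reductionLog :
    (∀ (N : ℕ) (ε : ℝ) (Φ : HardSphereFlow (Torus.geometry (Fin 3)) ε N) (z : Config N (Fin 3) T3),
      z ∈ Φ.good → ∀ (W L : ℝ), 0 < W → ∀ n : ℕ,
        (∀ a : ℕ, a < n → ∀ q r : Fin N,
            (r = q ∨ r ∈ Φ.backwardCluster q (a * W) ((a + 1) * W) z) →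
            Torus.euclidDist ((Φ.flow (a * W) z) r).1 ((Φ.flow ((a + 1) * W) z) q).1 ≤ L) →
        ∀ i j : Fin N, (j = i ∨ j ∈ Φ.backwardCluster i 0 (n * W) z) →
          Torus.euclidDist (z j).1 ((Φ.flow (n * W) z) i).1 ≤ n * L) →
    (∀ (N : ℕ) (ε : ℝ) (Φ : HardSphereFlow (Torus.geometry (Fin 3)) ε N) (z : Config N (Fin 3) T3),
      z ∈ Φ.good → ∀ (i : Fin N) (s t : ℝ),
        Φ.backwardCluster i s t z = Φ.backwardCluster i 0 (t - s) (Φ.flow s z)) →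
    (∀ (σ a θ : ℝ) (N : ℕ)
      (Φ : HardSphereFlow (Torus.geometry (Fin 3)) (hsDiameter σ N) (N + 1)) (s : ℝ),
      (localGibbsLaw σ (fun _ => a) (fun _ => 0) (fun _ => θ) N Φ).map (Φ.flow s) =
        localGibbsLaw σ (fun _ => a) (fun _ => 0) (fun _ => θ) N Φ) →
    (∀ (σ a θ : ℝ) (N : ℕ)
      (Φ : HardSphereFlow (Torus.geometry (Fin 3)) (hsDiameter σ N) (N + 1)),
      localGibbsLaw σ (fun _ => a) (fun _ => 0) (fun _ => θ) N Φ Φ.goodᶜ = 0) →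
    (∀ (t θ σ c C : ℝ), 0 < t → 0 < θ → 0 < σ → 0 < c →
      ∃ (K : ℝ) (n : ℕ → ℕ) (M : ℕ → ℝ), 0 < K ∧
        (∀ N, 0 < n N) ∧
        (∀ N, (n N : ℝ) * (M N * (((N + 1 : ℕ) : ℝ) ^ (-(1 / 3 : ℝ)) / σ ^ 2 / Real.sqrt θ)) = t) ∧
        (∀ᶠ N in atTop, 1 ≤ M N) ∧
        (∀ᶠ N in atTop, M N ≤ K * Real.log ((N : ℝ) + 2)) ∧
        Tendsto (fun N => ((N + 1 : ℕ) : ℝ) * (n N : ℝ) * (C * Real.exp (-c * M N))) atTop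
          (nhds 0)) →
    (∀ a θ : ℝ, 0 < a → 0 < θ → ∃ σ₀ : ℝ, 0 < σ₀ ∧ ∃ lam c C : ℝ, 0 < c ∧ ∀ K : ℝ, 0 < K →
      ∀ σ : ℝ, 0 < σ → σ < σ₀ →
      ∀ Φ : (N : ℕ) → HardSphereFlow (Torus.geometry (Fin 3)) (hsDiameter σ N) (N + 1),
      ∀ᶠ N in atTop, ∀ p : Fin (N + 1), ∀ M : ℝ, 1 ≤ M → M ≤ K * Real.log ((N : ℝ) + 2) →
        localGibbsLaw σ (fun _ => a) (fun _ => 0) (fun _ => θ) N (Φ N)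
          {z | ∃ r : Fin (N + 1),
              (r = p ∨ r ∈ (Φ N).backwardCluster p 0
                (M * (((N + 1 : ℕ) : ℝ) ^ (-(1 / 3 : ℝ)) / σ ^ 2 / Real.sqrt θ)) z) ∧
              lam * M * (((N + 1 : ℕ) : ℝ) ^ (-(1 / 3 : ℝ)) / σ ^ 2) <
                Torus.euclidDist (z r).1
                  (((Φ N).flow (M * (((N + 1 : ℕ) : ℝ) ^ (-(1 / 3 : ℝ)) / σ ^ 2 / Real.sqrt θ)) z)
                    p).1}
          ≤ ENNReal.ofReal (C * Real.exp (-c * M))) →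
    Summit.AtomisticToContinuum.HydrodynamicLimit.Theses.RelayRaceLocality.GibbsLightCone := by
  intro hWC hShift hInv hNull hAsy hTail
  unfold Summit.AtomisticToContinuum.HydrodynamicLimit.Theses.RelayRaceLocality.GibbsLightCone
  intro a θ ha hθ
  obtain ⟨σ₀, hσ₀, lam, c, C, hc, H⟩ := hTail a θ ha hθ
  have hsq : 0 < Real.sqrt θ := Real.sqrt_pos.2 hθ
  refine ⟨σ₀, hσ₀, max lam 1 * Real.sqrt θ, mul_pos (lt_max_of_lt_right one_pos) hsq, ?_⟩
  intro σ hσ hσσ₀ Φ t ht δ hδ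
  rcases ht.eq_or_lt with rfl | ht'
  · -- the `t = 0` slice is Gibbs-null
    refine tendsto_nhds_of_eventually_eq (Eventually.of_forall fun N => ?_)
    refine le_antisymm ((measure_mono ?_).trans (hNull σ a θ N (Φ N)).le) bot_le
    rintro z ⟨i, j, hij, hdist⟩ hz
    rcases hij with rfl | hmem
    · rw [(Φ N).flow_zero z hz, Torus.euclidDist_self] at hdist
      linarith
    · rw [(Φ N).backwardCluster_apply hz, backwardCluster_of_le (le_refl (0 : ℝ))] at hmem
      exact Finset.notMem_empty _ hmem
  · -- `t > 0`: log-window union bound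
    obtain ⟨K, n, M, hK, -, hprod, hM1, hMK, hlim⟩ := hAsy t θ σ c C ht' hθ hσ hc
    have hH := H K hK σ hσ hσσ₀ Φ
    have hupper : Tendsto (fun N => ((n N : ℕ) : ℝ≥0∞) *
        (((N + 1 : ℕ) : ℝ≥0∞) * ENNReal.ofReal (C * Real.exp (-c * M N)))) atTop (nhds 0) := by
      have h := ENNReal.tendsto_ofReal hlim
      rw [ENNReal.ofReal_zero] at h
      exact h.congr' (Eventually.of_forall fun N => reduction_ofReal_bound (N + 1) (n N) _)
    refine tendsto_of_tendsto_of_tendsto_of_le_of_le' tendsto_const_nhds hupper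
      (Eventually.of_forall fun _ => bot_le) ?_
    filter_upwards [hM1, hMK, hH] with N hMN hMKN hHN
    have hℓ : 0 < ((N + 1 : ℕ) : ℝ) ^ (-(1 / 3 : ℝ)) / σ ^ 2 := by positivity
    have hW : 0 < M N * (((N + 1 : ℕ) : ℝ) ^ (-(1 / 3 : ℝ)) / σ ^ 2 / Real.sqrt θ) :=
      mul_pos (by linarith) (div_pos hℓ hsq)
    have hL : (n N : ℝ) * (lam * M N * (((N + 1 : ℕ) : ℝ) ^ (-(1 / 3 : ℝ)) / σ ^ 2)) ≤
        max lam 1 * Real.sqrt θ * t :=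
      reduction_speed hθ hMN hℓ.le (hprod N)
    exact reduction_union_bound (Φ N) _ (hInv σ a θ N (Φ N)) (hNull σ a θ N (Φ N))
      (reduction_cover hWC hShift (Φ N) hW (hprod N) hL hδ)
      (reduction_iUnion_le _ _ fun q => hHN q (M N) hMN hMKN)

end Summit.AtomisticToContinuum.HydrodynamicLimit.Theorems.LogWindowTaggedTail
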